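import Mathlib.Algebra.Polynomial.Roots
import Mathlib.Algebra.Polynomial.AlgebraMap
import Mathlib.Algebra.Algebra.Rat
import Mathlib.Data.Set.Finite.Basic
import Mathlib.Tactic.FieldSimp
import Mathlib.Tactic.LinearCombination
import HarnessLib

/-!
# [GenEll] Thm 2.1 for `ℙ¹` (route piece W7, companion): the fibres of `t` and of `φ = β ∘ t` on the
# cover `D_e : r^e = x(1 − x)` are FINITE (at most `e + 3` points each)

Companion of `GenEllDeCoverFarFromCusps` (package W7 «properness» of seat abc-iut-S6's
`GENELLTWO-P1ROUTE.md`, owner w4-d031) for the cell's number-field-only proof of `GenEllTwo`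
(stmt-ABC-19679; S. Mochizuki, *Arithmetic elliptic curves in general position*, Math. J. Okayama
Univ. **52** (2010), Thm. 2.1, proof p. 12 [cite: MochizukiGenEll2010, Thm 2.1 p.12]): the covering
lemma (W8) needs the exceptional set `X_φ = x(E_φ)` to be FINITE. With `s = 1 − 2x`,
`t = r⁻¹ + r^k/s` (`e = 2k − 1`), a non-pole point of the fibre `t⁻¹(b)` satisfies
`s(1 − b r) = −r^{k+1}` and `s² = 1 − 4 r^e`, hence `r` is a root of the NONZERO polynomial
`G_b = (1 − 4X^e)(1 − bX)² − X^{e+3}` (`G_b(0) = 1`; `deg G_b ≤ e + 3 = deg t`), and `(x, r)` is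
recovered from `r` (`1 − b r ≠ 0`, `s = −r^{k+1}/(1 − br)`, `x = (1 − s)/2`). So `t⁻¹(b)` is finite
(`finite_fibre_t`), and so is `E_φ = φ⁻¹{0, ∞, 1} = ⋃_{b : p(b) q(b) (p−q)(b) = 0} t⁻¹(b)`
(`finite_fibre_phi`). Characteristic `0` (`ℂ`, `Q̄_2`). No definitions; classical; nothing here bears
on [IUTchIII] Cor. 3.12.
-/

namespace Literature.NumberTheory.DiophantineGeometry.GenEll

open Polynomial

variable {L : Type*} [Field L]

/-- On a non-pole point of the fibre `t⁻¹(b)` of `D_e`, the `r`-coordinate is a root of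
`G_b = (1 − 4X^e)(1 − bX)² − X^{e+3}`, and `1 − b r ≠ 0`. [folklore] -/
private theorem fibre_root {e k : ℕ} (hk : 2 * k = e + 1) {b x r : L}
    (hcurve : r ^ e = x * (1 - x)) (hr : r ≠ 0) (hs : 1 - 2 * x ≠ 0)
    (ht : r⁻¹ + r ^ k / (1 - 2 * x) = b) :
    1 - b * r ≠ 0 ∧ (1 - 2 * x) * (1 - b * r) = -r ^ (k + 1) ∧
      ((1 - 4 * X ^ e) * (1 - C b * X) ^ 2 - X ^ (e + 3) : L[X]).eval r = 0 := by
  -- the numerator relation `s + r^{k+1} - b r s = 0`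
  have hD : (1 - 2 * x) + r ^ (k + 1) - b * r * (1 - 2 * x) = 0 := by
    have h := ht
    field_simp at h
    linear_combination h
  have hrel : (1 - 2 * x) * (1 - b * r) = -r ^ (k + 1) := by linear_combination hD
  have hbr : 1 - b * r ≠ 0 := by
    intro h0
    rw [h0, mul_zero] at hrel
    exact hr (pow_eq_zero_iff (Nat.succ_ne_zero k) |>.mp (neg_eq_zero.mp hrel.symm))
  refine ⟨hbr, hrel, ?_⟩
  -- `s² = 1 - 4 r^e` and `s² (1 - br)² = r^{2k+2} = r^{e+3}`
  have hs2 : (1 - 2 * x) ^ 2 = 1 - 4 * r ^ e := by rw [hcurve]; ring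
  have hsq : (1 - 2 * x) ^ 2 * (1 - b * r) ^ 2 = r ^ (e + 3) := by
    have : ((1 - 2 * x) * (1 - b * r)) ^ 2 = (-r ^ (k + 1)) ^ 2 := by rw [hrel]
    rw [mul_pow] at this
    rw [this, neg_pow, ← pow_mul]
    have h2 : (k + 1) * 2 = e + 3 := by omega
    rw [h2]; ring
  simp only [eval_sub, eval_mul, eval_pow, eval_one, eval_X, eval_C, eval_ofNat]
  rw [← hs2]
  linear_combination hsq

variable [CharZero L]

/-- **Finiteness of the fibres of `t`**: for every `b`, the non-pole points `(x, r)` of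
`D_e : r^e = x(1−x)` with `t(x, r) = r⁻¹ + r^k/(1 − 2x) = b` form a finite set (they inject, via the
`r`-coordinate, into the roots of `G_b ≠ 0`). [cite: MochizukiGenEll2010, Thm 2.1 p.12] -/
theorem finite_fibre_t {e k : ℕ} (hk : 2 * k = e + 1) (b : L) :
    {P : L × L | P.2 ^ e = P.1 * (1 - P.1) ∧ P.2 ≠ 0 ∧ 1 - 2 * P.1 ≠ 0 ∧
      P.2⁻¹ + P.2 ^ k / (1 - 2 * P.1) = b}.Finite := by
  classical
  set G : L[X] := (1 - 4 * X ^ e) * (1 - C b * X) ^ 2 - X ^ (e + 3) with hG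
  have hG0 : G ≠ 0 := by
    intro h
    have : G.eval 0 = 0 := by rw [h, eval_zero]
    have he3 : e + 3 ≠ 0 := by omega
    simp [hG, zero_pow he3] at this
    rcases Nat.eq_zero_or_pos e with rfl | he
    · norm_num at this
    · rw [zero_pow he.ne'] at this; norm_num at this
  -- the reconstruction map `r ↦ (x(r), r)`
  let f : L → L × L := fun r => ((1 + r ^ (k + 1) / (1 - b * r)) / 2, r)
  refine (G.roots.toFinset.finite_toSet.image f).subset ?_
  rintro ⟨x, r⟩ ⟨hcurve, hr, hs, ht⟩
  obtain ⟨hbr, hrel, hroot⟩ := fibre_root hk hcurve hr hs ht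
  refine ⟨r, ?_, ?_⟩
  · have hroot' : G.eval r = 0 := by rw [hG]; exact hroot
    simp only [Finset.mem_coe, Multiset.mem_toFinset, mem_roots hG0, IsRoot.def]
    exact hroot'
  · -- `x = (1 - s)/2` with `s = -r^{k+1}/(1 - br)`
    have h1 : r ^ (k + 1) / (1 - b * r) = 2 * x - 1 := by
      rw [div_eq_iff hbr]
      linear_combination hrel
    change (((1 + r ^ (k + 1) / (1 - b * r)) / 2, r) : L × L) = (x, r)
    rw [h1]
    ext
    · show (1 + (2 * x - 1)) / 2 = x
      ring
    · rfl

/-- **Finiteness of the fibre `E_φ = φ⁻¹{0, ∞, 1}`** of `φ = β ∘ t`, `β = p/q` (`p, q ∈ ℚ[X]`,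
`p ≠ 0`, `q ≠ 0`, `p ≠ q`): the non-pole points of `D_e` at which `p(t) = 0`, `q(t) = 0` or
`(p − q)(t) = 0` form a finite set — a finite union of fibres of `t` over the roots of `p·q·(p−q)`.
(This is the exceptional set of mechanism `PHI(r)` of `GENELLTWO-P1ROUTE` §4.)
[cite: MochizukiGenEll2010, Thm 2.1 p.12] -/
theorem finite_fibre_phi {e k : ℕ} (hk : 2 * k = e + 1) {p q : ℚ[X]} (hp0 : p ≠ 0) (hq0 : q ≠ 0)
    (hne : p ≠ q) :
    {P : L × L | P.2 ^ e = P.1 * (1 - P.1) ∧ P.2 ≠ 0 ∧ 1 - 2 * P.1 ≠ 0 ∧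
      (aeval (P.2⁻¹ + P.2 ^ k / (1 - 2 * P.1)) p = 0 ∨
        aeval (P.2⁻¹ + P.2 ^ k / (1 - 2 * P.1)) q = 0 ∨
        aeval (P.2⁻¹ + P.2 ^ k / (1 - 2 * P.1)) (p - q) = 0)}.Finite := by
  classical
  -- the finite set of values `b` with `p(b) q(b) (p-q)(b) = 0`
  set f : ℚ[X] := p * q * (p - q) with hf
  have hf0 : f ≠ 0 := mul_ne_zero (mul_ne_zero hp0 hq0) (sub_ne_zero.mpr hne)
  have hfL : f.map (algebraMap ℚ L) ≠ 0 := (Polynomial.map_ne_zero_iff (algebraMap ℚ L).injective).mpr hf0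
  set B : Finset L := (f.map (algebraMap ℚ L)).roots.toFinset with hB
  refine ((B.finite_toSet.biUnion fun b _ => finite_fibre_t (L := L) hk b)).subset ?_
  rintro ⟨x, r⟩ ⟨hcurve, hr, hs, hval⟩
  simp only [Set.mem_iUnion, Set.mem_setOf_eq, Finset.mem_coe, exists_prop]
  refine ⟨r⁻¹ + r ^ k / (1 - 2 * x), ?_, hcurve, hr, hs, rfl⟩
  rw [hB, Multiset.mem_toFinset, mem_roots hfL, IsRoot.def, eval_map, ← aeval_def, hf, map_mul,
    map_mul]
  rcases hval with h | h | h
  · rw [h, zero_mul, zero_mul]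
  · rw [h, mul_zero, zero_mul]
  · rw [h, mul_zero]

end Literature.NumberTheory.DiophantineGeometry.GenEll
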